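import Summits.QuantumFields.BalabanUV.Beta.GAN24.DressedStepFaceCharges
import Summits.QuantumFields.BalabanUV.Beta.GAN24.ResolventLegCharges
import Summits.QuantumFields.BalabanUV.Beta.GAN24.DressedHalfVertex
import Summits.QuantumFields.BalabanUV.Beta.GAN24.MultiplierVertexBondSum

/-!
# `BalabanUV.Beta.GAN24.RespKernelColumnCharge` — binder row G-an2-4 ∕ (CONV-C), W-slot CT-W, conservation law (C)∕(C)sym, step (L3c)(ii) of this lineage's note
# `HOME/b2b-balaban-gan24-formalise-leaf-04/g66/CSYM-LEVEL0-KERNEL-BLUEPRINT.md` §8: **THE COARSE COLUMN CHARGES OF A COMPOSITION `A ∘ K`, AND OF THE DERIVATIVE OF THE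
# INVERSE `K2OfK X̃♮_j Lc S M μ c = −(X̃♮_j ∘ dM_{μ,c}) ∘ X̃♮_j` THROUGH THE DRESSED STEP KERNEL** — the right `X̃♮_j` factor, summed over its coarse multiplier columns `(Lc•z′, inr ν)`,
# turns into the exit-face field `h^{(ν)}(s′, inl a) = [a = ν]·𝟙f(s′_ν)·Lc·s_m s_f·σ_j` (multiplier legs `0`)

NOT IN PRINT; OUR BOOKKEEPING ([folklore] one-sided Fubini over TREE objects BY NAME: an5∕an4's `ExpKernelCalculus.comp ∕ Decays`, leaf-06's
`ResolventLegCharges.summable_exp_coarse' ∕ tsum_exp_coarse_le'`, this lineage's `DressedStepFaceCharges.hasSum_dressedStep_col` (g65); G-an2-4 formalisation swarm, leaf prover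
`b2b-balaban-gan24-formalise-leaf-04`, gen 66).  HONEST FRAMING (cell contract, verbatim): «discharging `BetaPertH` makes Bałaban's UV stability UNCONDITIONAL — a real constructive-QFT
result; it is NOT the continuum limit and NOT the Clay problem.»  HONEST DEPENDENCY (verbatim): «continuum YM on T⁴ ⇐ BetaPertH ∧ nine spine estimates (0/9 proved); BetaPertH ⇐ (D1) ∧
(D4) ∧ CAP+tail; G-an2-4 gates asym, D1 and NE2/3/4.»

WHY.  After `DressedSourceZeroModeLevelZero` the only unevaluated numbers of pieces (I)+(II) of the level-0 (C_1) balance are the two OUTER-SUMMED SECOND-RESPONSE WORDS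
`Σ_{c∈box}Σ'_{u′} FF[dM (K2_{μc}) Lc S M ν u′]`, `K2_{μc} = K2OfK X̃♮_0 Lc S♮_0 M μ c`.  Their outer slot resums through the COLUMN CHARGES of the fixed kernel `K2_{μc}`
(`DressedHalfVertex.hasSum_vertexOfK_bond_site`, `MultiplierVertexBondSum`): `Σ'_{z′} K2_{μc}(w, Lc•z′)(g, inr ν)`.  Since `K2 = −(X̃ ∘ V) ∘ X̃`, this file computes the coarse column
charges of a composition `A ∘ K` from those of `K` (§1, any `A` with summable rows, any decaying `K` with site-dependent charges) and instantiates at the dressed step kernel (§2): the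
charge of `K2_{μc}` on the leg `(w, g)` is `−Σ'_{s′} Σ_a (X̃♮_j ∘ dM_{μc})(w, s′)(g, inl a)·𝟙f(s′_a)·[a = ν]·Lc·s_m s_f·σ_j` — the composition `X̃♮_j ∘ dM_{μc}` paired with the
exit-face field in direction `ν`.

WHAT ([folklore]; generic `d`; 0 `def`, 0 cited facts, 0 `def … : Prop`, 0 sorry): §1 GENERIC block `N`: **`hasSum_comp_col_site`** — for `K` with `Decays K C δ` (`δ > 0`) and
site-dependent coarse column charges `HasSum (z′ ↦ K w (N•z′) g (inr β)) (ρR g w)`, and `A` with summable rows `s′ ↦ A w s′ g b`: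
`HasSum (z′ ↦ comp A K w (N•z′) g (inr β)) (Σ'_{s′} Σ_b A w s′ g b·ρR b s′)`; `hasSum_neg_comp_col_site`.  §2 DRESSED (in-block root, `1 ≤ Lc`, every `j`, all units; `S`
`LocStencil`, `M` `VertexFamily` at positive rates): `summable_row_comp_dressedStep_dM`, **`hasSum_K2OfK_dressedStep_col`**:
`HasSum (z′ ↦ K2OfK X̃♮_j Lc S M μ c w (Lc•z′) g (inr ν)) (−Σ'_{s′} Σ_b (X̃♮_j ∘ dM X̃♮_j Lc S M μ c)(w, s′)(g, b)·chg_ν(b, s′))` with `chg_ν = Sum.elim (a ↦ 𝟙f(s′_a)·Lc·s_m s_f·[a = ν]σ_j) 0`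
VERBATIM from `hasSum_dressedStep_col`.  §3 `summable_prod_of_centreTied`; **`tsum_twoFace_vertexOfK_fixed_bond`**: for a kernel `K′` bi-localised at ONE centre (e.g. `K2_{μc}`) with
site-dependent column charges `ρR`: `Σ'_{u′} FFρ[vertexOfK K′ N S ν u′] = Σ'_{(y,w)} ρ₁(y)ρ₂(w)·Σ_κ Σ'_t ρR (inl κ) t·S κ t y w f g` (centre-tied Fubini + this lineage's
`DressedHalfVertex.hasSum_vertexOfK_bond_site`) — the FIELD half of the outer-summed response word as a charge-weighted stencil sum; §4 **`tsum_twoFace_vertexOfK_K2OfK_dressedStep_bond`** — §3 at `K′ = K2OfK X̃♮_j Lc S M μ c`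
(an2's `vertexFamily_K2OfK`) with §2's charges: the field half of `B_{μ,ν}(c)` of `DressedSourceZeroModeLevelZero` in resummed form; §5 **`hasSum_vertexOfM_bond_site(′)`** (leaf-13's `hasSum_vertexOfM_bond_of_bound` with
NONZERO site-dependent `colM` charges `qM`: `HasSum (y ↦ vertexOfM K N M μ y x z a b) (Σ_ρ Σ'_w qM ρ w·M ρ w x z a b)`), **`hasSum_vertexOfM_K2OfK_dressedStep_bond`** (the multiplier half of
`B_{μ,ν}(c)`, pointwise, through §2's charges at the rows `(Lc•w, inr ρ′)` — NOT zero by (S2c)).  Asserts NO value of Bałaban's tables; discharges NOTHING of (C)sym ∕ (Q-D) ∕ (Q-D-rate) ∕ «T2Shape» ∕ «T2Drift» ∕ (hW, hWall); NEVER «G-an2-4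
closed» as (CONV-C); NOT D1, NOT `BetaPertH`, NOT continuum, NOT Clay.  2026-08-23; no existing file touched.
-/

noncomputable section

open Finset
open scoped BigOperators
open Literature.MathematicalPhysics.QuantumFieldTheory
open Literature.MathematicalPhysics.QuantumFieldTheory.Balaban1983to89
open Literature.MathematicalPhysics.QuantumFieldTheory.Balaban1983to89.Beta
open AffineAveraging (Site box toSite)
open B12Sec2to5 (l1 l1_nonneg)
open ExpKernelCalculus (MKer comp Decays BiLoc VertexFamily Zl Zl_nonneg biLoc_comp_decays summable_exp_shift')
open OneStepResolventKernel (Fib LocStencil biLoc_mono decays_mono)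
open OneStepKernelFamily (KInvStep decays_KInvStep vertexOfK)
open BalabanStepJets (locStencil_mono)
open InterLevelTransport (cwsum_apply)
open SecondOrderResponse (colM vertexOfM dM K2OfK vertexFamily_dM vertexFamily_K2OfK biLoc_vertexOfK_of_biLoc)
open Summit.QuantumFields.BalabanUV.Beta.GAN24.MultiplierVertexBondSum (summable_envelope abs_colM_le_fine)
open Summit.QuantumFields.BalabanUV.Beta.HessKerDressedUnits (unitK decays_unitK)
open Summit.QuantumFields.BalabanUV.Beta.AxialDressingRooted (coDressKBmAt decays_coDressKBmAt)
open Summit.QuantumFields.BalabanUV.Beta.GAN24.KernelLegCharges (summable_right_of_biLoc summable_exp_coarse)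
open Summit.QuantumFields.BalabanUV.Beta.GAN24.DMBondCharges (decays_of_biLoc)
open Summit.QuantumFields.BalabanUV.Beta.GAN24.DressedHalfVertex (hasSum_vertexOfK_bond_site)
open Summit.QuantumFields.BalabanUV.Beta.GAN24.ResolventLegCharges (summable_exp_coarse' tsum_exp_coarse_le')
open Summit.QuantumFields.BalabanUV.Beta.GAN24.DressedStepFaceCharges (hasSum_dressedStep_col)

namespace Summit.QuantumFields.BalabanUV.Beta.GAN24.RespKernelColumnCharge

variable {d : ℕ}

/-! ## §1 The coarse column charges of a composition -/

section Generic

variable {N : ℕ} [NeZero N]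

/-- [folklore] **THE COARSE COLUMN CHARGES OF `A ∘ K` FROM THOSE OF `K`** (one-sided Fubini): for `K` with `Decays K C δ` (`δ > 0`) whose coarse columns against `inr β` have the
site-dependent charges `ρR g w`, and any `A` whose row `s′ ↦ A w s′ g b` is summable for every fibre `b`,
`HasSum (z′ ↦ comp A K w (N•z′) g (inr β)) (Σ'_{s′} Σ_b A w s′ g b · ρR b s′)`. -/
theorem hasSum_comp_col_site {A K : MKer (d + 1) (Fib d)} {C δ : ℝ} (hK : Decays K C δ) (hδ : 0 < δ) (β : Fin (d + 1))
    {ρR : Fib d → Site (d + 1) → ℝ} (hcol : ∀ g w, HasSum (fun z' : Site (d + 1) => K w ((N : ℤ) • z') g (Sum.inr β)) (ρR g w))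
    (w : Site (d + 1)) (g : Fib d) (hA : ∀ b : Fib d, Summable fun s' : Site (d + 1) => A w s' g b) :
    HasSum (fun z' : Site (d + 1) => comp A K w ((N : ℤ) • z') g (Sum.inr β))
      (∑' s' : Site (d + 1), ∑ b : Fib d, A w s' g b * ρR b s') := by
  classical
  have hN : 1 ≤ N := Nat.one_le_iff_ne_zero.2 (NeZero.ne N)
  have hC : 0 ≤ C := hK.nonneg (Sum.inl 0)
  set U : ℝ := Real.exp (δ * ((N : ℝ) * (d + 1))) * Zl (d + 1) δ with hU
  have hU0 : 0 ≤ U := mul_nonneg (Real.exp_pos _).le (Zl_nonneg hδ)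
  -- the double family `(s′, z′) ↦ Σ_b A w s′ g b · K s′ (N•z′) b (inr β)` and its majorant
  set G : Site (d + 1) × Site (d + 1) → ℝ := fun q => ∑ b : Fib d, A w q.1 g b * K q.1 ((N : ℤ) • q.2) b (Sum.inr β) with hG
  set Mj : Site (d + 1) × Site (d + 1) → ℝ := fun q => (∑ b : Fib d, |A w q.1 g b|) * (C * Real.exp (-δ * l1 (q.1 - (N : ℤ) • q.2))) with hMj
  have hMj0 : ∀ q, 0 ≤ Mj q := fun q => mul_nonneg (Finset.sum_nonneg fun b _ => abs_nonneg _) (mul_nonneg hC (Real.exp_pos _).le)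
  have hGle : ∀ q, |G q| ≤ Mj q := by
    intro q
    refine (Finset.abs_sum_le_sum_abs _ _).trans ?_
    show ∑ i : Fib d, |A w q.1 g i * K q.1 ((N : ℤ) • q.2) i (Sum.inr β)| ≤ (∑ b : Fib d, |A w q.1 g b|) * (C * Real.exp (-δ * l1 (q.1 - (N : ℤ) • q.2)))
    rw [Finset.sum_mul]
    refine Finset.sum_le_sum fun b _ => ?_
    rw [abs_mul]
    exact mul_le_mul_of_nonneg_left (hK q.1 ((N : ℤ) • q.2) b (Sum.inr β)) (abs_nonneg _)
  have hAabs : Summable fun s' : Site (d + 1) => ∑ b : Fib d, |A w s' g b| :=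
    summable_sum fun b _ => (hA b).abs
  have hMj_in : ∀ s' : Site (d + 1), Summable fun z' : Site (d + 1) => Mj (s', z') := fun s' =>
    ((summable_exp_coarse' (d := d) hN hδ s').mul_left C).mul_left (∑ b : Fib d, |A w s' g b|)
  have hMj_out : Summable fun s' : Site (d + 1) => ∑' z' : Site (d + 1), Mj (s', z') := by
    refine Summable.of_nonneg_of_le (fun s' => tsum_nonneg fun z' => hMj0 (s', z')) (fun s' => ?_) (hAabs.mul_right (C * U))
    show ∑' z' : Site (d + 1), (∑ b : Fib d, |A w s' g b|) * (C * Real.exp (-δ * l1 (s' - (N : ℤ) • z'))) ≤ (∑ b : Fib d, |A w s' g b|) * (C * U)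
    rw [tsum_mul_left, tsum_mul_left]
    exact mul_le_mul_of_nonneg_left (mul_le_mul_of_nonneg_left (tsum_exp_coarse_le' N hδ s') hC) (Finset.sum_nonneg fun b _ => abs_nonneg _)
  have hMj_sum : Summable Mj := (summable_prod_of_nonneg hMj0).2 ⟨hMj_in, hMj_out⟩
  have hGs : Summable G := Summable.of_norm_bounded hMj_sum (fun q => by rw [Real.norm_eq_abs]; exact hGle q)
  -- fibres at fixed `s′`: the column charges of `K`
  have hfib : ∀ s' : Site (d + 1), HasSum (fun z' : Site (d + 1) => G (s', z')) (∑ b : Fib d, A w s' g b * ρR b s') := by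
    intro s'
    exact hasSum_sum fun b _ => (hcol b s').mul_left (A w s' g b)
  have hrow : HasSum (fun s' : Site (d + 1) => ∑ b : Fib d, A w s' g b * ρR b s') (∑' q, G q) := hGs.hasSum.prod_fiberwise hfib
  -- fibres at fixed `z′`: the entries of the composition
  have hGs' : Summable fun q : Site (d + 1) × Site (d + 1) => G (q.2, q.1) := hGs.prod_symm
  have hfib' : ∀ z' : Site (d + 1), HasSum (fun s' : Site (d + 1) => G (s', z')) (comp A K w ((N : ℤ) • z') g (Sum.inr β)) := by
    intro z'
    have h := (hGs'.prod_factor z').hasSum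
    exact h
  have hcol' : HasSum (fun z' : Site (d + 1) => comp A K w ((N : ℤ) • z') g (Sum.inr β)) (∑' q : Site (d + 1) × Site (d + 1), G (q.2, q.1)) :=
    hGs'.hasSum.prod_fiberwise hfib'
  have e : ∑' q : Site (d + 1) × Site (d + 1), G (q.2, q.1) = ∑' q, G q := (Equiv.prodComm (Site (d + 1)) (Site (d + 1))).tsum_eq G
  rw [e, ← hrow.tsum_eq] at hcol'
  exact hcol'

/-- [folklore] The same for `−(A ∘ K)` (the sign of `K2OfK`). -/
theorem hasSum_neg_comp_col_site {A K : MKer (d + 1) (Fib d)} {C δ : ℝ} (hK : Decays K C δ) (hδ : 0 < δ) (β : Fin (d + 1))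
    {ρR : Fib d → Site (d + 1) → ℝ} (hcol : ∀ g w, HasSum (fun z' : Site (d + 1) => K w ((N : ℤ) • z') g (Sum.inr β)) (ρR g w))
    (w : Site (d + 1)) (g : Fib d) (hA : ∀ b : Fib d, Summable fun s' : Site (d + 1) => A w s' g b) :
    HasSum (fun z' : Site (d + 1) => -(comp A K w ((N : ℤ) • z') g (Sum.inr β)))
      (-(∑' s' : Site (d + 1), ∑ b : Fib d, A w s' g b * ρR b s')) :=
  (hasSum_comp_col_site hK hδ β hcol w g hA).neg

end Generic

/-! ## §2 The column charges of the derivative of the inverse through the dressed step kernel -/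

section Dressed

variable {Lc : ℕ} [NeZero Lc] {r : Fin (d + 1) → ℕ} {S M : Fin (d + 1) → Site (d + 1) → MKer (d + 1) (Fib d)} {Cs δs CM δM : ℝ}

/-- [folklore] **THE ROWS OF `X̃♮_j ∘ dM X̃♮_j Lc S M μ c` ARE SUMMABLE** (the composition of the decaying dressed kernel with the bi-localised background derivative is
bi-localised — an2's `vertexFamily_dM` + `biLoc_comp_decays` — hence its rows are summable, `summable_right_of_biLoc`). -/
theorem summable_row_comp_dressedStep_dM (hLc : 1 ≤ Lc) (hr : r ∈ box (d + 1) Lc) (sf sm : ℝ) (j : ℕ)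
    (hS : LocStencil S Cs δs) (hδs : 0 < δs) (hM : VertexFamily M Lc CM δM) (hδM : 0 < δM)
    (μ : Fin (d + 1)) (c w : Site (d + 1)) (g b : Fib d) :
    Summable fun s' : Site (d + 1) =>
      comp (unitK sf sm (coDressKBmAt (toSite r) Lc (KInvStep (d := d) Lc j))) (dM (unitK sf sm (coDressKBmAt (toSite r) Lc (KInvStep (d := d) Lc j))) Lc S M μ c) w s' g b := by
  obtain ⟨δ, C, hδ, hC, hXd⟩ := decays_coDressKBmAt hLc hr (decays_KInvStep (d := d) (Lc := Lc) j)
  have hXu := decays_unitK (sf := sf) (sm := sm) hXd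
  have hCX : 0 ≤ max |sf| |sm| * C * max |sf| |sm| := by positivity
  have hCs : 0 ≤ Cs := (hS 0 0).nonneg (Sum.inl 0)
  have hCM : 0 ≤ CM := (hM 0 0).nonneg (Sum.inl 0)
  set m : ℝ := min (min δ δs) δM with hm_def
  have hm : 0 < m := lt_min (lt_min hδ hδs) hδM
  have hX1 : Decays (unitK sf sm (coDressKBmAt (toSite r) Lc (KInvStep (d := d) Lc j))) (max |sf| |sm| * C * max |sf| |sm|) m :=
    decays_mono hXu hCX le_rfl ((min_le_left _ _).trans (min_le_left _ _))
  have hS1 := locStencil_mono hS hCs ((min_le_left _ _).trans (min_le_right _ _) : m ≤ δs)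
  have hM1 : VertexFamily M Lc CM m := fun ρ' w' => biLoc_mono (hM ρ' w') hCM (min_le_right _ _)
  have hV := vertexFamily_dM (N := Lc) hX1 hCX hS1 hM1 hm le_rfl μ c
  have hX2 : Decays (unitK sf sm (coDressKBmAt (toSite r) Lc (KInvStep (d := d) Lc j))) (max |sf| |sm| * C * max |sf| |sm|) (m / 2) :=
    decays_mono hX1 hCX le_rfl (by linarith)
  have hB := biLoc_comp_decays hX2 hV (by positivity : (0 : ℝ) ≤ m / 4) (by linarith : m / 4 < m / 2)
  exact summable_right_of_biLoc hB (by positivity) g b w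

/-- [folklore] **THE COARSE COLUMN CHARGES OF `K2OfK X̃♮_j Lc S M μ c` AGAINST `inr ν`** (in-block root, `1 ≤ Lc`, every `j`, all units, `S` `LocStencil` and `M` `VertexFamily` at
positive rates; every row `(w, g)`): `HasSum (z′ ↦ K2OfK X̃♮_j Lc S M μ c w (Lc•z′) g (inr ν)) (−Σ'_{s′} Σ_b (X̃♮_j ∘ dM X̃♮_j Lc S M μ c)(w, s′)(g, b)·chg_ν(b, s′))`, `chg_ν` the dressed
column charge of `hasSum_dressedStep_col` — exit-face indicator on field legs in direction `ν`, zero on multiplier legs. -/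
theorem hasSum_K2OfK_dressedStep_col (hLc : 1 ≤ Lc) (hr : r ∈ box (d + 1) Lc) (sf sm : ℝ) (j : ℕ)
    (hS : LocStencil S Cs δs) (hδs : 0 < δs) (hM : VertexFamily M Lc CM δM) (hδM : 0 < δM)
    (μ : Fin (d + 1)) (c : Site (d + 1)) (ν : Fin (d + 1)) (w : Site (d + 1)) (g : Fib d) :
    HasSum (fun z' : Site (d + 1) =>
        K2OfK (unitK sf sm (coDressKBmAt (toSite r) Lc (KInvStep (d := d) Lc j))) Lc S M μ c w (((Lc : ℕ) : ℤ) • z') g (Sum.inr ν))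
      (-(∑' s' : Site (d + 1), ∑ b : Fib d,
          comp (unitK sf sm (coDressKBmAt (toSite r) Lc (KInvStep (d := d) Lc j))) (dM (unitK sf sm (coDressKBmAt (toSite r) Lc (KInvStep (d := d) Lc j))) Lc S M μ c) w s' g b *
            Sum.elim (fun a : Fin (d + 1) => if s' a % (Lc : ℤ) = (Lc : ℤ) - 1 then ((Lc : ℝ) * (sm * sf)) *
              (if a = ν then ((((Lc ^ (j + 1) : ℕ) : ℝ)) ^ (d + 1 + 1))⁻¹ else 0) else 0) (fun _ => (0 : ℝ)) b)) := by
  obtain ⟨δ, C, hδ, hC, hXd⟩ := decays_coDressKBmAt hLc hr (decays_KInvStep (d := d) (Lc := Lc) j)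
  have hXu := decays_unitK (sf := sf) (sm := sm) hXd
  have h := hasSum_neg_comp_col_site (N := Lc) hXu hδ ν (fun g' w' => hasSum_dressedStep_col hLc hr sf sm j ν g' w') w g
    (fun b => summable_row_comp_dressedStep_dM hLc hr sf sm j hS hδs hM hδM μ c w g b)
  refine h.congr_fun fun z' => ?_
  rfl

end Dressed


/-! ## §3 The outer slot of the field half of a response word, resummed through the column charges of a fixed centre-tied kernel -/

section OuterSlot

variable {N : ℕ} [NeZero N] {ρ₁ ρ₂ : Site (d + 1) → ℝ}

/-- [folklore] **A CENTRE-TIED FAMILY HAS AN ABSOLUTELY SUMMABLE `(u′, (y, w))` FAMILY** (the envelope of leaf-14's `MixedChannelBondSums` §1). -/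
theorem summable_prod_of_centreTied {V : Site (d + 1) → MKer (d + 1) (Fib d)} {Cv δv : ℝ} {c : Site (d + 1)} (hδv : 0 < δv)
    (hVb : ∀ u', BiLoc (V u') c c (Cv * Real.exp (-δv * l1 ((N : ℤ) • u' - c))) δv) (f g : Fib d) :
    Summable fun q : Site (d + 1) × (Site (d + 1) × Site (d + 1)) => V q.1 q.2.1 q.2.2 f g := by
  have hN : 1 ≤ N := Nat.one_le_iff_ne_zero.2 (NeZero.ne N)
  have hGle : ∀ q : Site (d + 1) × (Site (d + 1) × Site (d + 1)), |V q.1 q.2.1 q.2.2 f g| ≤ Cv * (Real.exp (-δv * l1 ((N : ℤ) • q.1 - c)) *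
      (Real.exp (-δv * l1 (q.2.1 - c)) * Real.exp (-δv * l1 (q.2.2 - c)))) := by
    intro q
    have h := hVb q.1 q.2.1 q.2.2 f g
    rw [mul_add, Real.exp_add, mul_assoc] at h
    exact h
  have hmaj : Summable fun q : Site (d + 1) × (Site (d + 1) × Site (d + 1)) =>
      Cv * (Real.exp (-δv * l1 ((N : ℤ) • q.1 - c)) * (Real.exp (-δv * l1 (q.2.1 - c)) * Real.exp (-δv * l1 (q.2.2 - c)))) := by
    have h1 := summable_exp_coarse (d := d) hN hδv c
    have h2 := summable_exp_shift' (D := d + 1) hδv c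
    have h23 := h2.mul_of_nonneg h2 (fun _ => (Real.exp_pos _).le) (fun _ => (Real.exp_pos _).le)
    exact (h1.mul_of_nonneg h23 (fun _ => (Real.exp_pos _).le) (fun _ => mul_nonneg (Real.exp_pos _).le (Real.exp_pos _).le)).mul_left Cv
  exact Summable.of_norm_bounded hmaj (fun q => by rw [Real.norm_eq_abs]; exact hGle q)

/-- [folklore] **THE OUTER SLOT OF `vertexOfK K′ N S ν u′` FOR A FIXED CENTRE-TIED KERNEL, RESUMMED UNDER THE FACE-WEIGHTED PAIR SUM**: for `K′` bi-localised at one centre `c`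
(rate `m > 0`; e.g. `K2OfK X̃♮ Lc S M μ c′`), with site-dependent coarse column charges `ρR` against `inr ν`, `S` a `LocStencil` at rate `m`, bounded weights:
`Σ'_{u′} Σ'_{(y,w)} ρ₁(y)ρ₂(w)·vertexOfK K′ N S ν u′ y w f g = Σ'_{(y,w)} ρ₁(y)ρ₂(w)·Σ_κ Σ'_t ρR (inl κ) t·S κ t y w f g` — the bond sum moved inside (centre-tied Fubini) and done by
this lineage's `DressedHalfVertex.hasSum_vertexOfK_bond_site` (`decays_of_biLoc`). -/
theorem tsum_twoFace_vertexOfK_fixed_bond {K' : MKer (d + 1) (Fib d)} {c : Site (d + 1)} {C m : ℝ} (hK : BiLoc K' c c C m) (hm : 0 < m) (ν : Fin (d + 1))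
    {ρR : Fib d → Site (d + 1) → ℝ} (hcol : ∀ g w, HasSum (fun z' : Site (d + 1) => K' w ((N : ℤ) • z') g (Sum.inr ν)) (ρR g w))
    {S : Fin (d + 1) → Site (d + 1) → MKer (d + 1) (Fib d)} {Cs : ℝ} (hS : LocStencil S Cs m)
    (h₁ : ∀ y, |ρ₁ y| ≤ 1) (h₂ : ∀ w, |ρ₂ w| ≤ 1) (f g : Fib d) :
    (∑' u' : Site (d + 1), ∑' yw : Site (d + 1) × Site (d + 1), ρ₁ yw.1 * ρ₂ yw.2 * vertexOfK K' N S ν u' yw.1 yw.2 f g)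
      = ∑' yw : Site (d + 1) × Site (d + 1), ρ₁ yw.1 * ρ₂ yw.2 * ∑ κ : Fin (d + 1), ∑' t : Site (d + 1), ρR (Sum.inl κ) t * S κ t yw.1 yw.2 f g := by
  have hC : 0 ≤ C := hK.nonneg (Sum.inl 0)
  have hCs : 0 ≤ Cs := (hS 0 0).nonneg (Sum.inl 0)
  -- pointwise bond sums
  have hpt : ∀ yw : Site (d + 1) × Site (d + 1), HasSum (fun u' : Site (d + 1) => ρ₁ yw.1 * ρ₂ yw.2 * vertexOfK K' N S ν u' yw.1 yw.2 f g)
      (ρ₁ yw.1 * ρ₂ yw.2 * ∑ κ : Fin (d + 1), ∑' t : Site (d + 1), ρR (Sum.inl κ) t * S κ t yw.1 yw.2 f g) :=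
    fun yw => (hasSum_vertexOfK_bond_site (N := N) (decays_of_biLoc hK hm.le) hm ν hcol hS yw.1 yw.2 f g).mul_left _
  -- the weighted family is centre-tied
  have hVb : ∀ u' : Site (d + 1), BiLoc (fun y w a b => ρ₁ y * ρ₂ w * vertexOfK K' N S ν u' y w a b) c c
      (((d + 1 : ℕ) * (C * Cs * Zl (d + 1) (m / 2))) * Real.exp (-(m / 2) * l1 ((N : ℤ) • u' - c))) (m / 2) := by
    intro u' y w a b
    have h := biLoc_vertexOfK_of_biLoc (N := N) hK hS hm ν u' y w a b
    have hZ := Zl_nonneg (D := d + 1) (half_pos hm)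
    have hl := l1_nonneg ((N : ℤ) • u' - c)
    have hexp : Real.exp (-m * l1 ((N : ℤ) • u' - c)) ≤ Real.exp (-(m / 2) * l1 ((N : ℤ) • u' - c)) := Real.exp_le_exp.2 (by nlinarith)
    have hK0 : 0 ≤ C * Cs * Zl (d + 1) (m / 2) := by positivity
    show |ρ₁ y * ρ₂ w * vertexOfK K' N S ν u' y w a b| ≤ _
    rw [abs_mul, abs_mul]
    calc |ρ₁ y| * |ρ₂ w| * |vertexOfK K' N S ν u' y w a b|
        ≤ 1 * 1 * ((d + 1 : ℕ) * (C * Real.exp (-m * l1 ((N : ℤ) • u' - c)) * Cs * Zl (d + 1) (m / 2)) * Real.exp (-(m / 2) * (l1 (y - c) + l1 (w - c)))) :=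
          mul_le_mul (mul_le_mul (h₁ y) (h₂ w) (abs_nonneg _) zero_le_one) h (abs_nonneg _) (by positivity)
      _ = ((d + 1 : ℕ) * (C * Cs * Zl (d + 1) (m / 2))) * Real.exp (-m * l1 ((N : ℤ) • u' - c)) * Real.exp (-(m / 2) * (l1 (y - c) + l1 (w - c))) := by ring
      _ ≤ ((d + 1 : ℕ) * (C * Cs * Zl (d + 1) (m / 2))) * Real.exp (-(m / 2) * l1 ((N : ℤ) • u' - c)) * Real.exp (-(m / 2) * (l1 (y - c) + l1 (w - c))) :=
          mul_le_mul_of_nonneg_right (mul_le_mul_of_nonneg_left hexp (by positivity)) (Real.exp_pos _).le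
  have hGs := summable_prod_of_centreTied (N := N) (V := fun u' => fun y w a b => ρ₁ y * ρ₂ w * vertexOfK K' N S ν u' y w a b) (half_pos hm) hVb f g
  have hGs' : Summable fun q : (Site (d + 1) × Site (d + 1)) × Site (d + 1) => ρ₁ q.1.1 * ρ₂ q.1.2 * vertexOfK K' N S ν q.2 q.1.1 q.1.2 f g := hGs.prod_symm
  calc (∑' u' : Site (d + 1), ∑' yw : Site (d + 1) × Site (d + 1), ρ₁ yw.1 * ρ₂ yw.2 * vertexOfK K' N S ν u' yw.1 yw.2 f g)
      = ∑' q : Site (d + 1) × (Site (d + 1) × Site (d + 1)), ρ₁ q.2.1 * ρ₂ q.2.2 * vertexOfK K' N S ν q.1 q.2.1 q.2.2 f g := hGs.tsum_prod.symm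
    _ = ∑' q : (Site (d + 1) × Site (d + 1)) × Site (d + 1), ρ₁ q.1.1 * ρ₂ q.1.2 * vertexOfK K' N S ν q.2 q.1.1 q.1.2 f g :=
        (Equiv.prodComm (Site (d + 1)) (Site (d + 1) × Site (d + 1))).tsum_eq
          (fun q : (Site (d + 1) × Site (d + 1)) × Site (d + 1) => ρ₁ q.1.1 * ρ₂ q.1.2 * vertexOfK K' N S ν q.2 q.1.1 q.1.2 f g)
    _ = ∑' yw : Site (d + 1) × Site (d + 1), ∑' u' : Site (d + 1), ρ₁ yw.1 * ρ₂ yw.2 * vertexOfK K' N S ν u' yw.1 yw.2 f g := hGs'.tsum_prod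
    _ = _ := tsum_congr fun yw => (hpt yw).tsum_eq

end OuterSlot


/-! ## §4 The field half of the outer-summed response word of the dressed source, resummed -/

section DressedOuter

variable {Lc : ℕ} [NeZero Lc] {r : Fin (d + 1) → ℕ} {ρ₁ ρ₂ : Site (d + 1) → ℝ} {S M : Fin (d + 1) → Site (d + 1) → MKer (d + 1) (Fib d)} {Cs δs CM δM : ℝ}

/-- [folklore] **THE FIELD HALF OF THE OUTER-SUMMED RESPONSE WORD `B_{μ,ν}(c)` OF `DressedSourceZeroModeLevelZero`, RESUMMED** (in-block root, `1 ≤ Lc`, every `j`, all units, `S`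
`LocStencil` ∕ `M` `VertexFamily` at positive rates, bounded weights, every fibre pair): with `K2_{μc} = K2OfK X̃♮_j Lc S M μ c` and its coarse column charges `q_{μc,ν}` of §2,
`Σ'_{u′} Σ'_{(y,w)} ρ₁(y)ρ₂(w)·vertexOfK K2_{μc} Lc S ν u′ y w f g = Σ'_{(y,w)} ρ₁(y)ρ₂(w)·Σ_κ Σ'_t q_{μc,ν}(inl κ, t)·S κ t y w f g`,
`q_{μc,ν}(g, t) = −Σ'_{s′} Σ_b (X̃♮_j ∘ dM X̃♮_j Lc S M μ c)(t, s′)(g, b)·chg_ν(b, s′)` — §3 at `K′ = K2_{μc}` (an2's `vertexFamily_K2OfK`: bi-localised at the cell bond) with §2's charges. -/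
theorem tsum_twoFace_vertexOfK_K2OfK_dressedStep_bond (hLc : 1 ≤ Lc) (hr : r ∈ box (d + 1) Lc) (sf sm : ℝ) (j : ℕ)
    (hS : LocStencil S Cs δs) (hδs : 0 < δs) (hM : VertexFamily M Lc CM δM) (hδM : 0 < δM) (h₁ : ∀ y, |ρ₁ y| ≤ 1) (h₂ : ∀ w, |ρ₂ w| ≤ 1)
    (μ : Fin (d + 1)) (c : Site (d + 1)) (ν : Fin (d + 1)) (f g : Fib d) :
    (∑' u' : Site (d + 1), ∑' yw : Site (d + 1) × Site (d + 1), ρ₁ yw.1 * ρ₂ yw.2 *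
        vertexOfK (K2OfK (unitK sf sm (coDressKBmAt (toSite r) Lc (KInvStep (d := d) Lc j))) Lc S M μ c) Lc S ν u' yw.1 yw.2 f g)
      = ∑' yw : Site (d + 1) × Site (d + 1), ρ₁ yw.1 * ρ₂ yw.2 * ∑ κ : Fin (d + 1), ∑' t : Site (d + 1),
          (-(∑' s' : Site (d + 1), ∑ b : Fib d,
              comp (unitK sf sm (coDressKBmAt (toSite r) Lc (KInvStep (d := d) Lc j))) (dM (unitK sf sm (coDressKBmAt (toSite r) Lc (KInvStep (d := d) Lc j))) Lc S M μ c) t s'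
                  (Sum.inl κ) b *
                Sum.elim (fun a : Fin (d + 1) => if s' a % (Lc : ℤ) = (Lc : ℤ) - 1 then ((Lc : ℝ) * (sm * sf)) *
                  (if a = ν then ((((Lc ^ (j + 1) : ℕ) : ℝ)) ^ (d + 1 + 1))⁻¹ else 0) else 0) (fun _ => (0 : ℝ)) b)) *
            S κ t yw.1 yw.2 f g := by
  obtain ⟨δ, C, hδ, hC, hXd⟩ := decays_coDressKBmAt hLc hr (decays_KInvStep (d := d) (Lc := Lc) j)
  have hXu := decays_unitK (sf := sf) (sm := sm) hXd
  have hCX : 0 ≤ max |sf| |sm| * C * max |sf| |sm| := by positivity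
  have hCs : 0 ≤ Cs := (hS 0 0).nonneg (Sum.inl 0)
  have hCM : 0 ≤ CM := (hM 0 0).nonneg (Sum.inl 0)
  set m : ℝ := min (min δ δs) δM with hm_def
  have hm : 0 < m := lt_min (lt_min hδ hδs) hδM
  have hX1 : Decays (unitK sf sm (coDressKBmAt (toSite r) Lc (KInvStep (d := d) Lc j))) (max |sf| |sm| * C * max |sf| |sm|) m :=
    decays_mono hXu hCX le_rfl ((min_le_left _ _).trans (min_le_left _ _))
  have hS1 := locStencil_mono hS hCs ((min_le_left _ _).trans (min_le_right _ _) : m ≤ δs)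
  have hM1 : VertexFamily M Lc CM m := fun ρ' w' => biLoc_mono (hM ρ' w') hCM (min_le_right _ _)
  have hK2 := vertexFamily_K2OfK (N := Lc) hX1 hCX hm hS1 hM1 μ c
  have hS8 := locStencil_mono hS1 hCs (by linarith : m / 8 ≤ m)
  exact tsum_twoFace_vertexOfK_fixed_bond (N := Lc) hK2 (by positivity) ν
    (fun g' t => hasSum_K2OfK_dressedStep_col hLc hr sf sm j hS hδs hM hδM μ c ν t g') hS8 h₁ h₂ f g

end DressedOuter


/-! ## §5 The multiplier half: the bond sum of `vertexOfM K′ N M ν y` through a kernel with site-dependent `colM` charges -/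

section MultiplierHalf

variable {N : ℕ} [NeZero N]

/-- [folklore] **THE BOND SUM OF THE MULTIPLIER VERTEX THROUGH A KERNEL WITH SITE-DEPENDENT `colM` BOND CHARGES** (leaf-06∕13's `hasSum_vertexOfM_bond_of_bound` with the zero
charge replaced by `qM ρ w`): `HasSum (y ↦ vertexOfM K N M μ y x z a b) (Σ_ρ Σ'_w qM ρ w · M ρ w x z a b)`. -/
theorem hasSum_vertexOfM_bond_site {K : MKer (d + 1) (Fib d)} {C m : ℝ} (hK : Decays K C m) (hm : 0 < m) (μ : Fin (d + 1))
    {qM : Fin (d + 1) → Site (d + 1) → ℝ} (hK0 : ∀ ρ w, HasSum (fun y : Site (d + 1) => colM K N μ y ρ w) (qM ρ w))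
    {M : Fin (d + 1) → Site (d + 1) → MKer (d + 1) (Fib d)} {x z : Site (d + 1)} {a b : Fib d} {CM δ : ℝ} (hCM : 0 ≤ CM)
    (hδ : 0 < δ) {p : Site (d + 1)} (hM : ∀ ρ w, |M ρ w x z a b| ≤ CM * Real.exp (-δ * l1 (p - (N : ℤ) • w))) :
    HasSum (fun y : Site (d + 1) => vertexOfM K N M μ y x z a b) (∑ ρ : Fin (d + 1), ∑' w : Site (d + 1), qM ρ w * M ρ w x z a b) := by
  have hC : 0 ≤ C := hK.nonneg (Sum.inl 0)
  have key : ∀ ρ : Fin (d + 1),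
      HasSum (fun y : Site (d + 1) => ∑' w : Site (d + 1), colM K N μ y ρ w * M ρ w x z a b) (∑' w : Site (d + 1), qM ρ w * M ρ w x z a b) := by
    intro ρ
    have hF_sum : Summable (fun q : Site (d + 1) × Site (d + 1) => colM K N μ q.2 ρ q.1 * M ρ q.1 x z a b) := by
      refine Summable.of_norm_bounded (summable_envelope (N := N) hC hm hCM hδ p) fun q => ?_
      rw [Real.norm_eq_abs, abs_mul, mul_comm (CM * _)]
      exact mul_le_mul (abs_colM_le_fine hK hm.le μ q.2 ρ q.1) (hM ρ q.1) (abs_nonneg _)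
        (mul_nonneg hC (Real.exp_pos _).le)
    -- summing `y` first: the fibres are the charges
    have h0 : HasSum (fun w : Site (d + 1) => qM ρ w * M ρ w x z a b)
        (∑' q : Site (d + 1) × Site (d + 1), colM K N μ q.2 ρ q.1 * M ρ q.1 x z a b) :=
      hF_sum.hasSum.prod_fiberwise fun w => (hK0 ρ w).mul_right (M ρ w x z a b)
    have htot : ∑' q : Site (d + 1) × Site (d + 1), colM K N μ q.2 ρ q.1 * M ρ q.1 x z a b = ∑' w : Site (d + 1), qM ρ w * M ρ w x z a b :=
      h0.tsum_eq.symm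
    -- summing `w` first
    have hF' := (Equiv.hasSum_iff (Equiv.prodComm (Site (d + 1)) (Site (d + 1)))).mpr hF_sum.hasSum
    have hS' := (Equiv.summable_iff (Equiv.prodComm (Site (d + 1)) (Site (d + 1)))).mpr hF_sum
    have h1 := hF'.prod_fiberwise fun y => (hS'.prod_factor y).hasSum
    rw [htot] at h1
    refine h1.congr_fun fun y => ?_
    rfl
  have hsum := hasSum_sum (s := (Finset.univ : Finset (Fin (d + 1)))) fun ρ _ => key ρ
  refine hsum.congr_fun fun y => ?_
  simp only [vertexOfM, cwsum_apply]

/-- [folklore] `VertexFamily` form. -/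
theorem hasSum_vertexOfM_bond_site' {K : MKer (d + 1) (Fib d)} {C m : ℝ} (hK : Decays K C m) (hm : 0 < m) (μ : Fin (d + 1))
    {qM : Fin (d + 1) → Site (d + 1) → ℝ} (hK0 : ∀ ρ w, HasSum (fun y : Site (d + 1) => colM K N μ y ρ w) (qM ρ w))
    {M : Fin (d + 1) → Site (d + 1) → MKer (d + 1) (Fib d)} {CM δ : ℝ} (hMv : VertexFamily M N CM δ) (hδ : 0 < δ)
    (x z : Site (d + 1)) (a b : Fib d) :
    HasSum (fun y : Site (d + 1) => vertexOfM K N M μ y x z a b) (∑ ρ : Fin (d + 1), ∑' w : Site (d + 1), qM ρ w * M ρ w x z a b) := by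
  have hCM : 0 ≤ CM := (hMv 0 0).nonneg (Sum.inl 0)
  refine hasSum_vertexOfM_bond_site hK hm μ hK0 (CM := CM) hCM hδ (p := x) (fun ρ w => ?_)
  refine (hMv ρ w x z a b).trans (mul_le_mul_of_nonneg_left ?_ hCM)
  rw [Real.exp_le_exp]
  nlinarith [l1_nonneg (z - (N : ℤ) • w), l1_nonneg (x - (N : ℤ) • w)]

end MultiplierHalf

section MultiplierHalfDressed

variable {Lc : ℕ} [NeZero Lc] {r : Fin (d + 1) → ℕ} {S M : Fin (d + 1) → Site (d + 1) → MKer (d + 1) (Fib d)} {Cs δs CM δM : ℝ}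

/-- [folklore] **THE MULTIPLIER HALF OF THE OUTER-SUMMED RESPONSE WORD, POINTWISE**: the bond sum of `vertexOfM (K2OfK X̃♮_j Lc S M μ c) Lc M ν y` reads the multiplier tables through the
`colM` charges of `K2_{μc}` — §2 at the rows `(Lc•w, inr ρ′)` — which are NOT zero ((S2c) is a property of `X̃♮`, not of `K2_{μc}`):
`HasSum (y ↦ vertexOfM K2_{μc} Lc M ν y x z a b) (Σ_{ρ′} Σ'_w q_{μc,ν}(inr ρ′, Lc•w)·M ρ′ w x z a b)`. -/
theorem hasSum_vertexOfM_K2OfK_dressedStep_bond (hLc : 1 ≤ Lc) (hr : r ∈ box (d + 1) Lc) (sf sm : ℝ) (j : ℕ)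
    (hS : LocStencil S Cs δs) (hδs : 0 < δs) (hM : VertexFamily M Lc CM δM) (hδM : 0 < δM)
    (μ : Fin (d + 1)) (c : Site (d + 1)) (ν : Fin (d + 1)) (x z : Site (d + 1)) (a b : Fib d) :
    HasSum (fun y : Site (d + 1) => vertexOfM (K2OfK (unitK sf sm (coDressKBmAt (toSite r) Lc (KInvStep (d := d) Lc j))) Lc S M μ c) Lc M ν y x z a b)
      (∑ ρ' : Fin (d + 1), ∑' w : Site (d + 1),
        (-(∑' s' : Site (d + 1), ∑ b' : Fib d,
            comp (unitK sf sm (coDressKBmAt (toSite r) Lc (KInvStep (d := d) Lc j))) (dM (unitK sf sm (coDressKBmAt (toSite r) Lc (KInvStep (d := d) Lc j))) Lc S M μ c)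
                (((Lc : ℕ) : ℤ) • w) s' (Sum.inr ρ') b' *
              Sum.elim (fun a' : Fin (d + 1) => if s' a' % (Lc : ℤ) = (Lc : ℤ) - 1 then ((Lc : ℝ) * (sm * sf)) *
                (if a' = ν then ((((Lc ^ (j + 1) : ℕ) : ℝ)) ^ (d + 1 + 1))⁻¹ else 0) else 0) (fun _ => (0 : ℝ)) b')) *
          M ρ' w x z a b) := by
  obtain ⟨δ, C, hδ, hC, hXd⟩ := decays_coDressKBmAt hLc hr (decays_KInvStep (d := d) (Lc := Lc) j)
  have hXu := decays_unitK (sf := sf) (sm := sm) hXd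
  have hCX : 0 ≤ max |sf| |sm| * C * max |sf| |sm| := by positivity
  have hCs : 0 ≤ Cs := (hS 0 0).nonneg (Sum.inl 0)
  have hCM : 0 ≤ CM := (hM 0 0).nonneg (Sum.inl 0)
  set m : ℝ := min (min δ δs) δM with hm_def
  have hm : 0 < m := lt_min (lt_min hδ hδs) hδM
  have hX1 : Decays (unitK sf sm (coDressKBmAt (toSite r) Lc (KInvStep (d := d) Lc j))) (max |sf| |sm| * C * max |sf| |sm|) m :=
    decays_mono hXu hCX le_rfl ((min_le_left _ _).trans (min_le_left _ _))
  have hS1 := locStencil_mono hS hCs ((min_le_left _ _).trans (min_le_right _ _) : m ≤ δs)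
  have hM1 : VertexFamily M Lc CM m := fun ρ' w' => biLoc_mono (hM ρ' w') hCM (min_le_right _ _)
  have hK2 := vertexFamily_K2OfK (N := Lc) hX1 hCX hm hS1 hM1 μ c
  have hM8 : VertexFamily M Lc CM (m / 8) := fun ρ' w' => biLoc_mono (hM1 ρ' w') hCM (by linarith)
  exact hasSum_vertexOfM_bond_site' (N := Lc) (decays_of_biLoc hK2 (by positivity)) (by positivity) ν
    (fun ρ' w => hasSum_K2OfK_dressedStep_col hLc hr sf sm j hS hδs hM hδM μ c ν (((Lc : ℕ) : ℤ) • w) (Sum.inr ρ')) hM8 (by positivity) x z a b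

end MultiplierHalfDressed

end Summit.QuantumFields.BalabanUV.Beta.GAN24.RespKernelColumnCharge

end
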